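import Mathlib
import HarnessLib
import Summits.ValiantsHypothesis.ValiantsHypothesis.Theorems.MonotoneRestorationOrbitCompressionQPRestricted
import Summits.ValiantsHypothesis.ValiantsHypothesis.Theorems.MonotoneRestorationOrbitCompressionQPStubOneIffDescent
import Summits.ValiantsHypothesis.ValiantsHypothesis.Theorems.MonotoneRestorationOrbitRestorationLinearVolumeQPSubThresholdDescent

/-!
# Route MonotoneRestoration — aside `OrbitCompressionQP` (stmt-ValiantsHypothesis-18332), line
# `expression_compression`: LIFTING ⟺ qp-DESCENT ⟺ THE REPAIRED FIRST STUB

`…OrbitCompressionQPRestricted` (p830600): for EVERY family `f` with square-symmetric circuits of quasi-polynomial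
orbit size, the restricted family `f↓_n = φ_n(f_{n+n})` satisfies the first stub of line `expression_compression`
outright.  Hence the repaired first stub holds for every matrix-symmetric qp-orbit family that IS a restriction.  This
file proves that this is the whole story:

  ★ `lift_iff_qpDescentAbove` : qp-LIFTING (every matrix-symmetric family with square-symmetric circuits of
    quasi-polynomial ORBIT size is the restriction `f↓` of a matrix-symmetric qp-orbit family `f` one level up)
    ⟺ ABOVE-THRESHOLD qp-DESCENT (⟺ the repaired Stub 1, `StubOneIffDescent.stub1_iff_qpDescentAbove`, p830538).

* `exists_lift_of_mem_narrowSpan` — a polynomial in the BIPARTITE narrow span of width `w` at level `n` is the block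
  restriction of a MATRIX-symmetric polynomial in the bipartite narrow span of the same width at level `n + n`
  (generator by generator: `hom_{E,n} = φ_n(N_E⁻¹ • hom_{E,n+n})`, `N_E ≥ 1` the number of admissible block
  colourings, `BlockDescent.aeval_block_homPoly`);
* `rename_cast_eq`, `matrixSymmetric_rename_cast`, `mem_diNarrowSpan_rename_cast` — transport along `m + m = N`;
* ★ `lift_of_qpDescent` — qp-descent ⟹ qp-LIFTING (descend `g_n` to the bipartite span, lift the expansion one level
  up, interpolate the odd levels by `0`; the lift has qp orbits by `OrbitSupport.qpOrbitFamily_of_diNarrowSpan`);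
* ★ `stub1_of_lift` — qp-LIFTING ⟹ the repaired Stub 1 (`OrbitCompressionRestricted.restrict_narrowExpression_of_qpOrbit`);
* ★ `lift_iff_qpDescentAbove`, `lift_iff_stub1`.

So the three faces of the open first half of the aside — EXPRESSION (repaired Stub 1), SPAN (qp-descent / S1c) and
FAMILY (qp-lifting) — are one statement.  Honest label: equivalences between OPEN statements; Stub 2, the aside and
VP ≠ VNP are NOT moved.  Def-free helper (`--supports stmt-ValiantsHypothesis-18332`); nothing here is a named fact.

References: Dawar–Pago–Seppelt 2025 (arXiv:2502.06740) Thm 1.1, §7 p. 45; Dwivedi–Pago–Seppelt 2026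
(arXiv:2601.09343) eq. (1), Outlook Q3.
-/

noncomputable section

open scoped Classical

-- `Summit.ValiantsHypothesis.ValiantsHypothesis.…` is the tree's single-conjunct layout (Sub = Summit).
set_option linter.dupNamespace false

namespace Summit.ValiantsHypothesis.ValiantsHypothesis.Theorems

namespace OrbitCompressionLift

open Literature.Computability.AlgebraicComplexity MvPolynomial
open Literature.Combinatorics.SimpleGraph (treewidth)

/-! ### Lifting a bipartite expansion one level up -/

/-- **A bipartitely narrow polynomial is the block restriction of a matrix-symmetric bipartitely narrow polynomial
one level up, same width.**  Generator by generator: `φ_n(hom_{E,n+n}) = N_E • hom_{E,n}` with `N_E ≥ 1`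
(`BlockDescent.aeval_block_homPoly`; the colouring "rows ↦ row block, columns ↦ column block" is admissible), so
`hom_{E,n} = φ_n(N_E⁻¹ • hom_{E,n+n})`. [folklore] -/
theorem exists_lift_of_mem_narrowSpan {n w : ℕ}
    (φ : Fin (n + n) × Fin (n + n) → MvPolynomial (Fin n × Fin n) ℂ)
    (hφ : ∀ i j : Fin n, φ (finSumFinEquiv (Sum.inl i), finSumFinEquiv (Sum.inr j)) = X (i, j) ∧
      φ (finSumFinEquiv (Sum.inl i), finSumFinEquiv (Sum.inl j)) = 0 ∧
      φ (finSumFinEquiv (Sum.inr i), finSumFinEquiv (Sum.inl j)) = 0 ∧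
      φ (finSumFinEquiv (Sum.inr i), finSumFinEquiv (Sum.inr j)) = 0)
    (p : MvPolynomial (Fin n × Fin n) ℂ)
    (hp : p ∈ Submodule.span ℂ {q : MvPolynomial (Fin n × Fin n) ℂ | ∃ (a b : ℕ) (F : Multiset (Fin a × Fin b)),
      treewidth (SimpleGraph.fromRel fun u v : Fin a ⊕ Fin b =>
          ∃ e ∈ F, u = Sum.inl e.1 ∧ v = Sum.inr e.2) ≤ w ∧ q = homPoly F n ℂ}) :
    ∃ P : MvPolynomial (Fin (n + n) × Fin (n + n)) ℂ,
      (∀ σ τ : Equiv.Perm (Fin (n + n)),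
        rename (fun ij : Fin (n + n) × Fin (n + n) => (σ ij.1, τ ij.2)) P = P) ∧
      P ∈ Submodule.span ℂ {q : MvPolynomial (Fin (n + n) × Fin (n + n)) ℂ |
        ∃ (a b : ℕ) (F : Multiset (Fin a × Fin b)),
          treewidth (SimpleGraph.fromRel fun u v : Fin a ⊕ Fin b =>
            ∃ e ∈ F, u = Sum.inl e.1 ∧ v = Sum.inr e.2) ≤ w ∧ q = homPoly F (n + n) ℂ} ∧
      aeval φ P = p := by
  induction hp using Submodule.span_induction with
  | mem q hq =>
    obtain ⟨a, b, E, hE, rfl⟩ := hq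
    -- the number of admissible block colourings is nonzero
    set N : ℕ := (Finset.univ.filter fun c : Fin (a + b) → Bool =>
        ∀ e ∈ E, c (finSumFinEquiv (Sum.inl e.1)) = false ∧
          c (finSumFinEquiv (Sum.inr e.2)) = true).card with hN
    have hNpos : (N : ℂ) ≠ 0 := by
      refine Nat.cast_ne_zero.2 (Finset.card_ne_zero.2
        ⟨fun u => Sum.elim (fun _ => false) (fun _ => true) (finSumFinEquiv.symm u),
          Finset.mem_filter.2 ⟨Finset.mem_univ _, fun e _ => ?_⟩⟩)
      simp only [Equiv.symm_apply_apply, Sum.elim_inl, Sum.elim_inr, and_self]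
    refine ⟨(N : ℂ)⁻¹ • homPoly E (n + n) ℂ, fun σ τ => ?_, ?_, ?_⟩
    · rw [map_smul, rename_perm_homPoly]
    · exact Submodule.smul_mem _ _ (Submodule.subset_span ⟨a, b, E, hE, rfl⟩)
    · rw [map_smul, BlockDescent.aeval_block_homPoly φ hφ E, ← hN, smul_smul, inv_mul_cancel₀ hNpos, one_smul]
  | zero => exact ⟨0, fun σ τ => by rw [map_zero], Submodule.zero_mem _, by rw [map_zero]⟩
  | add x y _ _ hx hy =>
    obtain ⟨P, hPs, hPm, hPx⟩ := hx
    obtain ⟨Q, hQs, hQm, hQy⟩ := hy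
    exact ⟨P + Q, fun σ τ => by rw [map_add, hPs, hQs], Submodule.add_mem _ hPm hQm,
      by rw [map_add, hPx, hQy]⟩
  | smul r x _ hx =>
    obtain ⟨P, hPs, hPm, hPx⟩ := hx
    exact ⟨r • P, fun σ τ => by rw [map_smul, hPs], Submodule.smul_mem _ r hPm,
      by rw [map_smul, hPx]⟩

/-! ### Transport along `m + m = N` -/

/-- Renaming along a cast `Fin M = Fin N` from a PROVED `M = N` is the identity after substitution. [folklore] -/
theorem rename_cast_eq {M : ℕ} (e : M = M) (q : MvPolynomial (Fin M × Fin M) ℂ) :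
    rename (fun ij : Fin M × Fin M => (Fin.cast e ij.1, Fin.cast e ij.2)) q = q := by
  have h : (fun ij : Fin M × Fin M => (Fin.cast e ij.1, Fin.cast e ij.2)) = id :=
    funext fun ij => Prod.ext (Fin.ext rfl) (Fin.ext rfl)
  rw [h]
  exact rename_id_apply q

/-- Transport of matrix symmetry along `M = N`. [folklore] -/
theorem matrixSymmetric_rename_cast {M N : ℕ} (e : M = N) (q : MvPolynomial (Fin M × Fin M) ℂ)
    (hq : ∀ σ τ : Equiv.Perm (Fin M), rename (fun ij : Fin M × Fin M => (σ ij.1, τ ij.2)) q = q)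
    (σ τ : Equiv.Perm (Fin N)) :
    rename (fun ij : Fin N × Fin N => (σ ij.1, τ ij.2))
      (rename (fun ij : Fin M × Fin M => (Fin.cast e ij.1, Fin.cast e ij.2)) q) =
      rename (fun ij : Fin M × Fin M => (Fin.cast e ij.1, Fin.cast e ij.2)) q := by
  subst e
  rw [rename_cast_eq]
  exact hq σ τ

/-- Transport of one-sorted narrowness along `M = N` (the width may be rewritten along `e` as well). [folklore] -/
theorem mem_diNarrowSpan_rename_cast {M N w : ℕ} (e : M = N) (q : MvPolynomial (Fin M × Fin M) ℂ)
    (hq : q ∈ Submodule.span ℂ {r : MvPolynomial (Fin M × Fin M) ℂ |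
      ∃ (a : ℕ) (D : Multiset (Fin a × Fin a)),
        treewidth (SimpleGraph.fromRel fun u v : Fin a => ∃ d ∈ D, u = d.1 ∧ v = d.2) ≤ w ∧
          r = diHomPoly D M ℂ}) :
    rename (fun ij : Fin M × Fin M => (Fin.cast e ij.1, Fin.cast e ij.2)) q ∈
      Submodule.span ℂ {r : MvPolynomial (Fin N × Fin N) ℂ |
        ∃ (a : ℕ) (D : Multiset (Fin a × Fin a)),
          treewidth (SimpleGraph.fromRel fun u v : Fin a => ∃ d ∈ D, u = d.1 ∧ v = d.2) ≤ w ∧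
            r = diHomPoly D N ℂ} := by
  subst e
  rw [rename_cast_eq]
  exact hq

/-! ### qp-descent ⟹ qp-lifting -/

/-- ★ **qp-DESCENT ⟹ qp-LIFTING.**  Assume qp-descent in all degrees.  Then every MATRIX-symmetric family `g` with
square-symmetric circuits of quasi-polynomial orbit size is a RESTRICTION: there is a matrix-symmetric family `f`
with square-symmetric circuits of quasi-polynomial orbit size such that `g_n = φ_n(f_{n+n})` for every `n`.
(Descend `g_n` to the bipartite narrow span — support theorem in span form + descent —, lift its expansion one level
up by `exists_lift_of_mem_narrowSpan`, put `0` on the odd levels; the lift lies level-wise in the one-sorted narrow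
span, hence has qp orbits, `OrbitSupport.qpOrbitFamily_of_diNarrowSpan`.) [cite: DawarPagoSeppelt2025, Theorem 1.1 and §7 (p. 45)] -/
theorem lift_of_qpDescent
    (hdesc : ∀ c : ℕ, ∃ c' : ℕ, ∀ (n : ℕ) (p : MvPolynomial (Fin n × Fin n) ℂ),
      (∀ σ τ : Equiv.Perm (Fin n), rename (fun ij : Fin n × Fin n => (σ ij.1, τ ij.2)) p = p) →
      p ∈ Submodule.span ℂ {q : MvPolynomial (Fin n × Fin n) ℂ |
        ∃ (a : ℕ) (D : Multiset (Fin a × Fin a)),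
          treewidth (SimpleGraph.fromRel fun u v : Fin a => ∃ e ∈ D, u = e.1 ∧ v = e.2) ≤
            (Nat.log 2 n + c) ^ c ∧ q = diHomPoly D n ℂ} →
      p ∈ Submodule.span ℂ {q : MvPolynomial (Fin n × Fin n) ℂ | ∃ (a b : ℕ) (F : Multiset (Fin a × Fin b)),
        treewidth (SimpleGraph.fromRel fun u v : Fin a ⊕ Fin b =>
            ∃ e ∈ F, u = Sum.inl e.1 ∧ v = Sum.inr e.2) ≤ (Nat.log 2 n + c') ^ c' ∧ q = homPoly F n ℂ})
    (φ : (n : ℕ) → Fin (n + n) × Fin (n + n) → MvPolynomial (Fin n × Fin n) ℂ)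
    (hφ : ∀ n (i j : Fin n), φ n (finSumFinEquiv (Sum.inl i), finSumFinEquiv (Sum.inr j)) = X (i, j) ∧
      φ n (finSumFinEquiv (Sum.inl i), finSumFinEquiv (Sum.inl j)) = 0 ∧
      φ n (finSumFinEquiv (Sum.inr i), finSumFinEquiv (Sum.inl j)) = 0 ∧
      φ n (finSumFinEquiv (Sum.inr i), finSumFinEquiv (Sum.inr j)) = 0)
    (g : (n : ℕ) → MvPolynomial (Fin n × Fin n) ℂ)
    (hsymm : ∀ (n : ℕ) (σ τ : Equiv.Perm (Fin n)),
      rename (fun ij : Fin n × Fin n => (σ ij.1, τ ij.2)) (g n) = g n)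
    (horb : ∃ c : ℕ, ∀ n : ℕ, ∃ (G : Type) (_ : Fintype G)
        (C : LabelledArithCircuit ℂ (Fin n × Fin n) Unit G),
      C.IsSymmetric (Equiv.Perm (Fin n)) ∧ C.eval (C.output ()) = g n ∧
      C.orbitSize (Equiv.Perm (Fin n)) ≤ 2 ^ ((Nat.log 2 n + c) ^ c)) :
    ∃ f : (n : ℕ) → MvPolynomial (Fin n × Fin n) ℂ,
      (∀ (n : ℕ) (σ τ : Equiv.Perm (Fin n)),
        rename (fun ij : Fin n × Fin n => (σ ij.1, τ ij.2)) (f n) = f n) ∧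
      (∃ c : ℕ, ∀ n : ℕ, ∃ (G : Type) (_ : Fintype G)
          (C : LabelledArithCircuit ℂ (Fin n × Fin n) Unit G),
        C.IsSymmetric (Equiv.Perm (Fin n)) ∧ C.eval (C.output ()) = f n ∧
        C.orbitSize (Equiv.Perm (Fin n)) ≤ 2 ^ ((Nat.log 2 n + c) ^ c)) ∧
      ∀ n, aeval (φ n) (f (n + n)) = g n := by
  -- descend `g` to the bipartite span
  obtain ⟨c, hc⟩ := OrbitSupport.diNarrowSpan_of_qpOrbitFamily g horb
  obtain ⟨c', hc'⟩ := hdesc c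
  have hW : ∀ n, g n ∈ Submodule.span ℂ {q : MvPolynomial (Fin n × Fin n) ℂ |
      ∃ (a b : ℕ) (F : Multiset (Fin a × Fin b)),
        treewidth (SimpleGraph.fromRel fun u v : Fin a ⊕ Fin b =>
            ∃ e ∈ F, u = Sum.inl e.1 ∧ v = Sum.inr e.2) ≤ (Nat.log 2 n + c') ^ c' ∧ q = homPoly F n ℂ} :=
    fun n => hc' n (g n) (hsymm n) (hc n)
  -- lift level by level
  have hlift := fun n => exists_lift_of_mem_narrowSpan (φ n) (hφ n) (g n) (hW n)
  choose P hPs hPm hPg using hlift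
  -- the one-sorted narrowness of the lifts, at the width read at level `n + n`
  have hPU : ∀ n, P n ∈ Submodule.span ℂ {q : MvPolynomial (Fin (n + n) × Fin (n + n)) ℂ |
      ∃ (a : ℕ) (D : Multiset (Fin a × Fin a)),
        treewidth (SimpleGraph.fromRel fun u v : Fin a => ∃ e ∈ D, u = e.1 ∧ v = e.2) ≤
          (Nat.log 2 (n + n) + c') ^ c' ∧ q = diHomPoly D (n + n) ℂ} := by
    intro n
    refine SubThresholdDescent.narrowSpan_le_diNarrowSpan (n + n) _
      (OrbitToNarrowOfDescent.narrowSpan_mono (n + n) ?_ (hPm n))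
    exact Nat.pow_le_pow_left (by
      have := Nat.log_mono_right (b := 2) (Nat.le_add_right n n)
      omega) c'
  -- the family: lifts on the even levels, `0` on the odd ones
  let f : (N : ℕ) → MvPolynomial (Fin N × Fin N) ℂ := fun N =>
    if h : N % 2 = 0 then
      rename (fun ij : Fin (N / 2 + N / 2) × Fin (N / 2 + N / 2) =>
        (Fin.cast (by omega) ij.1, Fin.cast (by omega) ij.2)) (P (N / 2))
    else 0
  have hf_even : ∀ N (h : N % 2 = 0), f N =
      rename (fun ij : Fin (N / 2 + N / 2) × Fin (N / 2 + N / 2) =>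
        (Fin.cast (by omega) ij.1, Fin.cast (by omega) ij.2)) (P (N / 2)) := fun N h => by
    simp only [f, dif_pos h]
  have hf_odd : ∀ N, ¬ N % 2 = 0 → f N = 0 := fun N h => by
    simp only [f, dif_neg h]
  have hfsymm : ∀ (N : ℕ) (σ τ : Equiv.Perm (Fin N)),
      rename (fun ij : Fin N × Fin N => (σ ij.1, τ ij.2)) (f N) = f N := by
    intro N σ τ
    by_cases h : N % 2 = 0
    · rw [hf_even N h]
      exact matrixSymmetric_rename_cast _ (P (N / 2)) (hPs (N / 2)) σ τ
    · rw [hf_odd N h, map_zero]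
  have hfU : ∀ N : ℕ, f N ∈ Submodule.span ℂ {q : MvPolynomial (Fin N × Fin N) ℂ |
      ∃ (a : ℕ) (D : Multiset (Fin a × Fin a)),
        treewidth (SimpleGraph.fromRel fun u v : Fin a => ∃ e ∈ D, u = e.1 ∧ v = e.2) ≤
          (Nat.log 2 N + c') ^ c' ∧ q = diHomPoly D N ℂ} := by
    intro N
    by_cases h : N % 2 = 0
    · rw [hf_even N h]
      have e : N / 2 + N / 2 = N := by omega
      have hmem := mem_diNarrowSpan_rename_cast e (P (N / 2)) (hPU (N / 2))
      have hw : (Nat.log 2 (N / 2 + N / 2) + c') ^ c' = (Nat.log 2 N + c') ^ c' := by rw [e]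
      rw [hw] at hmem
      exact hmem
    · rw [hf_odd N h]
      exact Submodule.zero_mem _
  have hfdiag : ∀ (N : ℕ) (σ : Equiv.Perm (Fin N)), ren σ (f N) = f N := by
    intro N σ
    have hfun : (fun x : Fin N × Fin N => σ • x) = fun ij : Fin N × Fin N => (σ ij.1, σ ij.2) :=
      funext fun _ => rfl
    unfold ren
    rw [hfun]
    exact hfsymm N σ σ
  refine ⟨f, hfsymm, OrbitSupport.qpOrbitFamily_of_diNarrowSpan f hfdiag ⟨c', hfU⟩, fun n => ?_⟩
  -- `φ_n (f (n + n)) = g n`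
  have hcast : ∀ (m : ℕ) (e : m + m = n + n),
      aeval (φ n) (rename (fun ij : Fin (m + m) × Fin (m + m) =>
        (Fin.cast e ij.1, Fin.cast e ij.2)) (P m)) = g n := by
    intro m e
    obtain rfl : m = n := by omega
    rw [rename_cast_eq, hPg]
  have h : (n + n) % 2 = 0 := by omega
  rw [hf_even (n + n) h]
  exact hcast _ _

/-! ### qp-lifting ⟹ the repaired Stub 1 -/

/-- ★ **qp-LIFTING ⟹ THE REPAIRED STUB 1.**  If every matrix-symmetric qp-orbit family is a restriction `f↓` of a
matrix-symmetric qp-orbit family, then every such family has narrow bipartite expressions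
(`OrbitCompressionRestricted.restrict_narrowExpression_of_qpOrbit` for `f`). [cite: DawarPagoSeppelt2025, Theorem 1.1] -/
theorem stub1_of_lift
    (φ : (n : ℕ) → Fin (n + n) × Fin (n + n) → MvPolynomial (Fin n × Fin n) ℂ)
    (hφ : ∀ n (i j : Fin n), φ n (finSumFinEquiv (Sum.inl i), finSumFinEquiv (Sum.inr j)) = X (i, j) ∧
      φ n (finSumFinEquiv (Sum.inl i), finSumFinEquiv (Sum.inl j)) = 0 ∧
      φ n (finSumFinEquiv (Sum.inr i), finSumFinEquiv (Sum.inl j)) = 0 ∧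
      φ n (finSumFinEquiv (Sum.inr i), finSumFinEquiv (Sum.inr j)) = 0)
    (hlift : ∀ g : (n : ℕ) → MvPolynomial (Fin n × Fin n) ℂ,
      (∀ (n : ℕ) (σ τ : Equiv.Perm (Fin n)),
        rename (fun ij : Fin n × Fin n => (σ ij.1, τ ij.2)) (g n) = g n) →
      (∃ c : ℕ, ∀ n : ℕ, ∃ (G : Type) (_ : Fintype G)
          (C : LabelledArithCircuit ℂ (Fin n × Fin n) Unit G),
        C.IsSymmetric (Equiv.Perm (Fin n)) ∧ C.eval (C.output ()) = g n ∧
        C.orbitSize (Equiv.Perm (Fin n)) ≤ 2 ^ ((Nat.log 2 n + c) ^ c)) →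
      ∃ f : (n : ℕ) → MvPolynomial (Fin n × Fin n) ℂ,
        (∀ (n : ℕ) (σ τ : Equiv.Perm (Fin n)),
          rename (fun ij : Fin n × Fin n => (σ ij.1, τ ij.2)) (f n) = f n) ∧
        (∃ c : ℕ, ∀ n : ℕ, ∃ (G : Type) (_ : Fintype G)
            (C : LabelledArithCircuit ℂ (Fin n × Fin n) Unit G),
          C.IsSymmetric (Equiv.Perm (Fin n)) ∧ C.eval (C.output ()) = f n ∧
          C.orbitSize (Equiv.Perm (Fin n)) ≤ 2 ^ ((Nat.log 2 n + c) ^ c)) ∧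
        ∀ n, aeval (φ n) (f (n + n)) = g n) :
    ∀ g : (n : ℕ) → MvPolynomial (Fin n × Fin n) ℂ,
      (∀ (n : ℕ) (σ τ : Equiv.Perm (Fin n)),
        rename (fun ij : Fin n × Fin n => (σ ij.1, τ ij.2)) (g n) = g n) →
      (∃ c : ℕ, ∀ n : ℕ, ∃ (G : Type) (_ : Fintype G)
          (C : LabelledArithCircuit ℂ (Fin n × Fin n) Unit G),
        C.IsSymmetric (Equiv.Perm (Fin n)) ∧ C.eval (C.output ()) = g n ∧
        C.orbitSize (Equiv.Perm (Fin n)) ≤ 2 ^ ((Nat.log 2 n + c) ^ c)) →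
      ∃ c : ℕ, ∀ n : ℕ, 1 ≤ n → ∃ (k l : ℕ) (e : PatternExpr ℂ k l),
        n ^ (k + l) ≤ 2 ^ ((Nat.log 2 n + c) ^ c) ∧ e.close n = g n := by
  intro g hsymm horb
  obtain ⟨f, -, hforb, hfg⟩ := hlift g hsymm horb
  obtain ⟨c, hc⟩ := OrbitCompressionRestricted.restrict_narrowExpression_of_qpOrbit φ hφ f hforb
  refine ⟨c, fun n hn => ?_⟩
  obtain ⟨k, l, e, hk, he⟩ := hc n hn
  exact ⟨k, l, e, hk, he.trans (hfg n)⟩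

/-! ### The equivalences -/

/-- ★★ **qp-LIFTING ⟺ ABOVE-THRESHOLD qp-DESCENT** (⟹: `stub1_of_lift` then `StubOneIffDescent.stub1_iff_qpDescentAbove`;
⟸: `StubOneIffDescent.qpDescentAbove_iff_qpDescent` then `lift_of_qpDescent`).  With p830538 the three faces of the
open first half of the aside — repaired Stub 1 (expressions), S1c / qp-descent (spans), qp-lifting (families) — are
ONE statement. [cite: DawarPagoSeppelt2025, Theorem 1.1 and §7 (p. 45)] -/
theorem lift_iff_qpDescentAbove
    (φ : (n : ℕ) → Fin (n + n) × Fin (n + n) → MvPolynomial (Fin n × Fin n) ℂ)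
    (hφ : ∀ n (i j : Fin n), φ n (finSumFinEquiv (Sum.inl i), finSumFinEquiv (Sum.inr j)) = X (i, j) ∧
      φ n (finSumFinEquiv (Sum.inl i), finSumFinEquiv (Sum.inl j)) = 0 ∧
      φ n (finSumFinEquiv (Sum.inr i), finSumFinEquiv (Sum.inl j)) = 0 ∧
      φ n (finSumFinEquiv (Sum.inr i), finSumFinEquiv (Sum.inr j)) = 0) :
    (∀ g : (n : ℕ) → MvPolynomial (Fin n × Fin n) ℂ,
      (∀ (n : ℕ) (σ τ : Equiv.Perm (Fin n)),
        rename (fun ij : Fin n × Fin n => (σ ij.1, τ ij.2)) (g n) = g n) →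
      (∃ c : ℕ, ∀ n : ℕ, ∃ (G : Type) (_ : Fintype G)
          (C : LabelledArithCircuit ℂ (Fin n × Fin n) Unit G),
        C.IsSymmetric (Equiv.Perm (Fin n)) ∧ C.eval (C.output ()) = g n ∧
        C.orbitSize (Equiv.Perm (Fin n)) ≤ 2 ^ ((Nat.log 2 n + c) ^ c)) →
      ∃ f : (n : ℕ) → MvPolynomial (Fin n × Fin n) ℂ,
        (∀ (n : ℕ) (σ τ : Equiv.Perm (Fin n)),
          rename (fun ij : Fin n × Fin n => (σ ij.1, τ ij.2)) (f n) = f n) ∧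
        (∃ c : ℕ, ∀ n : ℕ, ∃ (G : Type) (_ : Fintype G)
            (C : LabelledArithCircuit ℂ (Fin n × Fin n) Unit G),
          C.IsSymmetric (Equiv.Perm (Fin n)) ∧ C.eval (C.output ()) = f n ∧
          C.orbitSize (Equiv.Perm (Fin n)) ≤ 2 ^ ((Nat.log 2 n + c) ^ c)) ∧
        ∀ n, aeval (φ n) (f (n + n)) = g n) ↔
    (∀ c : ℕ, ∃ c' : ℕ, ∀ (n : ℕ) (p : MvPolynomial (Fin n × Fin n) ℂ),
      (∀ σ τ : Equiv.Perm (Fin n), rename (fun ij : Fin n × Fin n => (σ ij.1, τ ij.2)) p = p) →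
      n < 2 * p.totalDegree →
      p ∈ Submodule.span ℂ {q : MvPolynomial (Fin n × Fin n) ℂ |
        ∃ (a : ℕ) (D : Multiset (Fin a × Fin a)),
          treewidth (SimpleGraph.fromRel fun u v : Fin a => ∃ e ∈ D, u = e.1 ∧ v = e.2) ≤
            (Nat.log 2 n + c) ^ c ∧ q = diHomPoly D n ℂ} →
      p ∈ Submodule.span ℂ {q : MvPolynomial (Fin n × Fin n) ℂ | ∃ (a b : ℕ) (F : Multiset (Fin a × Fin b)),
        treewidth (SimpleGraph.fromRel fun u v : Fin a ⊕ Fin b =>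
            ∃ e ∈ F, u = Sum.inl e.1 ∧ v = Sum.inr e.2) ≤ (Nat.log 2 n + c') ^ c' ∧ q = homPoly F n ℂ}) := by
  constructor
  · intro hlift
    exact StubOneIffDescent.stub1_iff_qpDescentAbove.1 (stub1_of_lift φ hφ hlift)
  · intro hdesc
    exact lift_of_qpDescent (StubOneIffDescent.qpDescentAbove_iff_qpDescent.1 hdesc) φ hφ

/-- **qp-LIFTING ⟺ THE REPAIRED STUB 1.** [cite: DawarPagoSeppelt2025, Theorem 1.1 and §7 (p. 45)] -/
theorem lift_iff_stub1
    (φ : (n : ℕ) → Fin (n + n) × Fin (n + n) → MvPolynomial (Fin n × Fin n) ℂ)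
    (hφ : ∀ n (i j : Fin n), φ n (finSumFinEquiv (Sum.inl i), finSumFinEquiv (Sum.inr j)) = X (i, j) ∧
      φ n (finSumFinEquiv (Sum.inl i), finSumFinEquiv (Sum.inl j)) = 0 ∧
      φ n (finSumFinEquiv (Sum.inr i), finSumFinEquiv (Sum.inl j)) = 0 ∧
      φ n (finSumFinEquiv (Sum.inr i), finSumFinEquiv (Sum.inr j)) = 0) :
    (∀ g : (n : ℕ) → MvPolynomial (Fin n × Fin n) ℂ,
      (∀ (n : ℕ) (σ τ : Equiv.Perm (Fin n)),
        rename (fun ij : Fin n × Fin n => (σ ij.1, τ ij.2)) (g n) = g n) →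
      (∃ c : ℕ, ∀ n : ℕ, ∃ (G : Type) (_ : Fintype G)
          (C : LabelledArithCircuit ℂ (Fin n × Fin n) Unit G),
        C.IsSymmetric (Equiv.Perm (Fin n)) ∧ C.eval (C.output ()) = g n ∧
        C.orbitSize (Equiv.Perm (Fin n)) ≤ 2 ^ ((Nat.log 2 n + c) ^ c)) →
      ∃ f : (n : ℕ) → MvPolynomial (Fin n × Fin n) ℂ,
        (∀ (n : ℕ) (σ τ : Equiv.Perm (Fin n)),
          rename (fun ij : Fin n × Fin n => (σ ij.1, τ ij.2)) (f n) = f n) ∧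
        (∃ c : ℕ, ∀ n : ℕ, ∃ (G : Type) (_ : Fintype G)
            (C : LabelledArithCircuit ℂ (Fin n × Fin n) Unit G),
          C.IsSymmetric (Equiv.Perm (Fin n)) ∧ C.eval (C.output ()) = f n ∧
          C.orbitSize (Equiv.Perm (Fin n)) ≤ 2 ^ ((Nat.log 2 n + c) ^ c)) ∧
        ∀ n, aeval (φ n) (f (n + n)) = g n) ↔
    (∀ f : (n : ℕ) → MvPolynomial (Fin n × Fin n) ℂ,
      (∀ (n : ℕ) (σ τ : Equiv.Perm (Fin n)),
        rename (fun ij : Fin n × Fin n => (σ ij.1, τ ij.2)) (f n) = f n) →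
      (∃ c : ℕ, ∀ n : ℕ, ∃ (G : Type) (_ : Fintype G)
          (C : LabelledArithCircuit ℂ (Fin n × Fin n) Unit G),
        C.IsSymmetric (Equiv.Perm (Fin n)) ∧ C.eval (C.output ()) = f n ∧
        C.orbitSize (Equiv.Perm (Fin n)) ≤ 2 ^ ((Nat.log 2 n + c) ^ c)) →
      ∃ c : ℕ, ∀ n : ℕ, 1 ≤ n → ∃ (k l : ℕ) (e : PatternExpr ℂ k l),
        n ^ (k + l) ≤ 2 ^ ((Nat.log 2 n + c) ^ c) ∧ e.close n = f n) :=
  (lift_iff_qpDescentAbove φ hφ).trans StubOneIffDescent.stub1_iff_qpDescentAbove.symm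

end OrbitCompressionLift

end Summit.ValiantsHypothesis.ValiantsHypothesis.Theorems

end
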